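import Summits.Ventures.LatticeQCDFlow.Scoring.TorusPartitionFunctionContinuumLimit
import Summits.Ventures.LatticeQCDFlow.Scoring.SU2TorusWilsonLoops
import HarnessLib

/-!
# The continuum limit of the `SU(2)` Wilson loops on the torus (the genus-one Migdal–Rusakov formula as a limit)

HONEST FRAMING: exact (Metropolis-corrected) sampling algorithms for lattice gauge theory;
figures of merit are autocorrelation/cost numbers at stated couplings and volumes; no
continuum-physics claim.

Venture `LatticeQCDFlow` (cell pub-lqcd), sub-topic `Scoring`; FANOUT row 5 (`s0-sun-a`), GEN-15.
NEW WORK of the cell (placement rule).  `Scoring/SU2TorusWilsonLoops.lean` typed the exact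
contractible `R × T` Wilson loop of theory-2's `SU(2)` Wilson measure on `(ℤ/L)²`:
`⟨½ tr W⟩ = ½Σ_n[λ_n^{A}(n+1)λ_{n+1}^{V−A}/(n+2) + λ_{n+1}^{A}(n+2)λ_n^{V−A}/(n+1)]/Σ_n λ_n^{V}`,
`A = RT`, `V = L²`, `λ_n = e^{−2β}(I_n(2β) − I_{n+2}(2β))/(n+1) = e^{−2β} I_{n+1}(2β)/β`.  With
`ρ_n = λ_n/λ_0 = I_{n+1}(2β)/I₁(2β)` and the power limits of `Scoring/BesselIRatioPowerLimit.lean`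
(`ρ_n(2β_j)^{A_j} → e^{−a n(n+2)/4}` when `A_j/β_j → a`):

* `su2_loop_term_eq` — the normalised term: dividing by `λ_0^V` turns each term into
  `½[ρ_n^{A} ρ_{n+1}^{V−A} (n+1)/(n+2) + ρ_{n+1}^{A} ρ_n^{V−A} (n+2)/(n+1)]`;
* `tendsto_tsum_su2_loop_terms` — dominated convergence of the numerator (each term `≤ (3/2) ρ_n^V`,
  geometric majorant);
* **`tendsto_wilson_mean_su2a0_loop`** — **THE CONTINUUM LIMIT**: if `β_j → ∞`,
  `1 ≤ R_j, T_j ≤ L_j`, `R_j T_j/β_j → a`, `L_j²/β_j → v > 0`, then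
  `⟨½ tr W_{R_j×T_j}⟩_{L_j,β_j} → ½Σ_n[e^{−a n(n+2)/4} e^{−(v−a)(n+1)(n+3)/4}(n+1)/(n+2)
      + e^{−a(n+1)(n+3)/4} e^{−(v−a) n(n+2)/4}(n+2)/(n+1)] / Σ_n e^{−v n(n+2)/4}`
  — the genus-one continuum formula (areas `a` inside, `v − a` outside the loop, Casimir
  `n(n+2)/4 = s(s+1)`, fusion `½ ⊗ s = (s ± ½)`), obtained as an honest limit of the lattice model.
  At `a = 0` the limit is `1`; for `v → ∞` at fixed `a` it tends to the plane area law `e^{−3a/4}`.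

Elementary given the parents; nothing is cited.  No sampler values.
-/

noncomputable section

open Real Filter Topology Set MeasureTheory
open scoped ENNReal
open Literature.Analysis.FunctionSpaces
open Literature.MathematicalPhysics.QuantumFieldTheory
open Literature.MathematicalPhysics.QuantumLattice
open Summit.Ventures.LatticeQCDFlow.Exactness Summit.Ventures.LatticeQCDFlow.Theory2.Lattice

namespace Summit.Ventures.LatticeQCDFlow.Scoring

/-! ### 1. The normalised terms -/

/-- `λ_n = e^{−2β}(I_n(2β) − I_{n+2}(2β))/(n+1) = e^{−2β} I_{n+1}(2β)/β` (`β ≠ 0`; the recurrence). -/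
theorem su2_charTerm_eq {β : ℝ} (hβ : β ≠ 0) (n : ℕ) :
    Real.exp (-(2 * β)) * (besselI n (2 * β) - besselI (n + 2) (2 * β)) / ((n : ℝ) + 1) =
      Real.exp (-(2 * β)) * besselI (n + 1) (2 * β) / β := by
  have h := mul_besselI_sub_besselI_add_two n (2 * β)
  have hn : ((n : ℝ) + 1) ≠ 0 := by positivity
  rw [div_eq_div_iff hn hβ]
  linear_combination (Real.exp (-(2 * β)) / 2) * h

/-- The same one order up, in the syntactic shape of `Scoring/SU2TorusWilsonLoops.lean`:
`e^{−2β}(I_{n+1}(2β) − I_{n+1+2}(2β))/(n+2) = e^{−2β} I_{n+2}(2β)/β`. -/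
theorem su2_charTerm_succ_eq {β : ℝ} (hβ : β ≠ 0) (n : ℕ) :
    Real.exp (-(2 * β)) * (besselI (n + 1) (2 * β) - besselI (n + 1 + 2) (2 * β)) / ((n : ℝ) + 2) =
      Real.exp (-(2 * β)) * besselI (n + 2) (2 * β) / β := by
  have h := mul_besselI_sub_besselI_add_two (n + 1) (2 * β)
  have hn : ((n : ℝ) + 2) ≠ 0 := by positivity
  rw [div_eq_div_iff hn hβ, show n + 1 + 2 = n + 1 + 2 from rfl, show n + 2 = n + 1 + 1 from rfl]
  push_cast at h ⊢
  linear_combination (Real.exp (-(2 * β)) / 2) * h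

/-- `(I_{n+1}(x_j)/I₁(x_j))^{C_j} → e^{−c n(n+2)/2}` when `x_j → ∞`, `C_j/x_j → c`
(`Scoring/BesselIRatioPowerLimit.lean` at `a = 1`). -/
theorem tendsto_besselI_succ_ratio_pow_of {x : ℕ → ℝ} {C : ℕ → ℕ} {c : ℝ} (hx : Tendsto x atTop atTop)
    (hc : Tendsto (fun j => (C j : ℝ) / x j) atTop (𝓝 c)) (n : ℕ) :
    Tendsto (fun j => (besselI (n + 1) (x j) / besselI 1 (x j)) ^ C j) atTop
      (𝓝 (Real.exp (-(c * ((n : ℝ) * (n + 2) / 2))))) := by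
  have h := tendsto_besselI_ratio_pow hx hc 1 n
  rw [Nat.add_comm 1 n] at h
  have e : c * ((n : ℝ) * (2 * ((1 : ℕ) : ℝ) + n) / 2) = c * ((n : ℝ) * (n + 2) / 2) := by push_cast; ring
  rw [e] at h
  exact h

/-- **The normalised loop term**: with `λ_n = e^{−2β} I_{n+1}(2β)/β`, `ρ_n = I_{n+1}(2β)/I₁(2β)` and
`A ≤ V`, `λ_n^{A}(n+1)λ_{n+1}^{V−A}/(n+2) + λ_{n+1}^{A}(n+2)λ_n^{V−A}/(n+1)
  = λ_0^V · (ρ_n^{A} ρ_{n+1}^{V−A}(n+1)/(n+2) + ρ_{n+1}^{A} ρ_n^{V−A}(n+2)/(n+1))`. -/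
theorem su2_loop_term_eq {β : ℝ} (hβ : 0 < β) {A V : ℕ} (hAV : A ≤ V) (n : ℕ) :
    (Real.exp (-(2 * β)) * besselI (n + 1) (2 * β) / β) ^ A * ((n : ℝ) + 1) *
        (Real.exp (-(2 * β)) * besselI (n + 2) (2 * β) / β) ^ (V - A) / ((n : ℝ) + 2) +
      (Real.exp (-(2 * β)) * besselI (n + 2) (2 * β) / β) ^ A * ((n : ℝ) + 2) *
        (Real.exp (-(2 * β)) * besselI (n + 1) (2 * β) / β) ^ (V - A) / ((n : ℝ) + 1) =
      (Real.exp (-(2 * β)) * besselI 1 (2 * β) / β) ^ V *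
        ((besselI (n + 1) (2 * β) / besselI 1 (2 * β)) ^ A * ((n : ℝ) + 1) *
            (besselI (n + 2) (2 * β) / besselI 1 (2 * β)) ^ (V - A) / ((n : ℝ) + 2) +
          (besselI (n + 2) (2 * β) / besselI 1 (2 * β)) ^ A * ((n : ℝ) + 2) *
            (besselI (n + 1) (2 * β) / besselI 1 (2 * β)) ^ (V - A) / ((n : ℝ) + 1)) := by
  have hI1 : 0 < besselI 1 (2 * β) := besselI_pos 1 (by linarith)
  set l0 := Real.exp (-(2 * β)) * besselI 1 (2 * β) / β with hl0
  have hl : ∀ m : ℕ, Real.exp (-(2 * β)) * besselI m (2 * β) / β = l0 * (besselI m (2 * β) / besselI 1 (2 * β)) := by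
    intro m; rw [hl0]; field_simp
  rw [hl (n + 1), hl (n + 2), mul_pow, mul_pow, mul_pow, mul_pow]
  have hV : l0 ^ V = l0 ^ A * l0 ^ (V - A) := by rw [← pow_add, Nat.add_sub_cancel' hAV]
  rw [hV]
  ring

/-! ### 2. The continuum limit of the numerator -/

/-- **Numerator**: if `x_j = 2β_j → ∞`, `A_j ≤ V_j`, `A_j/β_j → a`, `V_j/β_j → v > 0`, then
`Σ_n ½[ρ_n^{A_j} ρ_{n+1}^{V_j−A_j}(n+1)/(n+2) + ρ_{n+1}^{A_j} ρ_n^{V_j−A_j}(n+2)/(n+1)]`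
converges to the same sum with `ρ_n^{A} ↦ e^{−a n(n+2)/4}`, `ρ_{n+1}^{V−A} ↦ e^{−(v−a)(n+1)(n+3)/4}`. -/
theorem tendsto_tsum_su2_loop_terms {β : ℕ → ℝ} {A V : ℕ → ℕ} {a v : ℝ} (hv0 : 0 < v)
    (hβ : Tendsto β atTop atTop) (hAV : ∀ j, A j ≤ V j)
    (ha : Tendsto (fun j => (A j : ℝ) / β j) atTop (𝓝 a))
    (hv : Tendsto (fun j => (V j : ℝ) / β j) atTop (𝓝 v)) :
    Tendsto (fun j => ∑' n : ℕ, (1 / 2) *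
        ((besselI (n + 1) (2 * β j) / besselI 1 (2 * β j)) ^ A j * ((n : ℝ) + 1) *
            (besselI (n + 2) (2 * β j) / besselI 1 (2 * β j)) ^ (V j - A j) / ((n : ℝ) + 2) +
          (besselI (n + 2) (2 * β j) / besselI 1 (2 * β j)) ^ A j * ((n : ℝ) + 2) *
            (besselI (n + 1) (2 * β j) / besselI 1 (2 * β j)) ^ (V j - A j) / ((n : ℝ) + 1)))
      atTop (𝓝 (∑' n : ℕ, (1 / 2) *
        (Real.exp (-(a * (n : ℝ) * (n + 2) / 4)) * ((n : ℝ) + 1) *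
            Real.exp (-((v - a) * ((n : ℝ) + 1) * (n + 3) / 4)) / ((n : ℝ) + 2) +
          Real.exp (-(a * ((n : ℝ) + 1) * (n + 3) / 4)) * ((n : ℝ) + 2) *
            Real.exp (-((v - a) * (n : ℝ) * (n + 2) / 4)) / ((n : ℝ) + 1)))) := by
  -- the sequence `x_j = 2β_j` and the three ratios
  have hx : Tendsto (fun j => 2 * β j) atTop atTop := hβ.const_mul_atTop (by norm_num)
  have hax : Tendsto (fun j => (A j : ℝ) / (2 * β j)) atTop (𝓝 (a / 2)) := by
    refine (ha.div_const 2).congr fun j => ?_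
    rw [div_div, mul_comm]
  have hvx : Tendsto (fun j => (V j : ℝ) / (2 * β j)) atTop (𝓝 (v / 2)) := by
    refine (hv.div_const 2).congr fun j => ?_
    rw [div_div, mul_comm]
  have hdx : Tendsto (fun j => ((V j - A j : ℕ) : ℝ) / (2 * β j)) atTop (𝓝 ((v - a) / 2)) := by
    have := (hvx.sub hax)
    rw [show v / 2 - a / 2 = (v - a) / 2 by ring] at this
    refine this.congr fun j => ?_
    rw [Nat.cast_sub (hAV j), sub_div]
  -- termwise limits
  have hlim : ∀ n : ℕ, Tendsto (fun j =>
      (1 / 2) * ((besselI (n + 1) (2 * β j) / besselI 1 (2 * β j)) ^ A j * ((n : ℝ) + 1) *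
          (besselI (n + 2) (2 * β j) / besselI 1 (2 * β j)) ^ (V j - A j) / ((n : ℝ) + 2) +
        (besselI (n + 2) (2 * β j) / besselI 1 (2 * β j)) ^ A j * ((n : ℝ) + 2) *
          (besselI (n + 1) (2 * β j) / besselI 1 (2 * β j)) ^ (V j - A j) / ((n : ℝ) + 1)))
      atTop (𝓝 ((1 / 2) * (Real.exp (-(a * (n : ℝ) * (n + 2) / 4)) * ((n : ℝ) + 1) *
          Real.exp (-((v - a) * ((n : ℝ) + 1) * (n + 3) / 4)) / ((n : ℝ) + 2) +
        Real.exp (-(a * ((n : ℝ) + 1) * (n + 3) / 4)) * ((n : ℝ) + 2) *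
          Real.exp (-((v - a) * (n : ℝ) * (n + 2) / 4)) / ((n : ℝ) + 1)))) := by
    intro n
    -- `ρ_n^{A} → e^{−a n(n+2)/4}`, `ρ_{n+1}^{V−A} → e^{−(v−a)(n+1)(n+3)/4}`, and the swapped pair
    have h1 := tendsto_besselI_succ_ratio_pow_of hx hax n
    have h2 := tendsto_besselI_succ_ratio_pow_of hx hdx (n + 1)
    have h3 := tendsto_besselI_succ_ratio_pow_of hx hax (n + 1)
    have h4 := tendsto_besselI_succ_ratio_pow_of hx hdx n
    have e1 : a / 2 * ((n : ℝ) * (n + 2) / 2) = a * (n : ℝ) * (n + 2) / 4 := by ring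
    have e2 : (v - a) / 2 * (((n + 1 : ℕ) : ℝ) * (((n + 1 : ℕ) : ℝ) + 2) / 2) =
        (v - a) * ((n : ℝ) + 1) * (n + 3) / 4 := by push_cast; ring
    have e3 : a / 2 * (((n + 1 : ℕ) : ℝ) * (((n + 1 : ℕ) : ℝ) + 2) / 2) = a * ((n : ℝ) + 1) * (n + 3) / 4 := by
      push_cast; ring
    have e4 : (v - a) / 2 * ((n : ℝ) * (n + 2) / 2) = (v - a) * (n : ℝ) * (n + 2) / 4 := by ring
    rw [e1] at h1
    rw [e2] at h2
    rw [e3] at h3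
    rw [e4] at h4
    have hA := ((h1.mul_const ((n : ℝ) + 1)).mul h2).div_const ((n : ℝ) + 2)
    have hB := ((h3.mul_const ((n : ℝ) + 2)).mul h4).div_const ((n : ℝ) + 1)
    exact (hA.add hB).const_mul (1 / 2)
  -- domination by `(3/2) ρ_n^V ≤ (3/2) e^{c₂} e^{−c n}`
  have hv2 : 0 < v / 2 := by positivity
  set c := min (v / 2 / 2 / 4) (1 / 2) with hc
  have hc0 : 0 < c := lt_min (by positivity) (by norm_num)
  refine tendsto_tsum_of_dominated_convergence
    (bound := fun n : ℕ => 3 / 2 * (Real.exp (2 * (v / 2)) * Real.exp (-(c * n)))) ?_ hlim ?_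
  · exact ((summable_exp_neg_mul_nat hc0).mul_left _).mul_left _
  · filter_upwards [eventually_continuumLimit_bounds hv2 hx hvx] with j hj n
    obtain ⟨hj0, hlo, hhi, h2⟩ := hj
    have hI1 : 0 < besselI 1 (2 * β j) := besselI_pos 1 hj0
    set ρ : ℕ → ℝ := fun m => besselI (m + 1) (2 * β j) / besselI 1 (2 * β j) with hρ
    have hρ0 : ∀ m, 0 ≤ ρ m := fun m => div_nonneg (besselI_pos _ hj0).le hI1.le
    have hρ1 : ∀ m, ρ m ≤ 1 := fun m =>
      (div_le_one hI1).2 (besselI_le_besselI_of_le (by omega) (by linarith))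
    have hρmono : ρ (n + 1) ≤ ρ n :=
      div_le_div_of_nonneg_right (besselI_succ_le (n + 1) (by linarith)) hI1.le
    have hpow := besselI_ratio_one_pow_le hj0 (by positivity) hlo hhi h2 n
    -- both products are `≤ ρ_n^V`
    have hAVj := hAV j
    have hP1 : ρ n ^ A j * ρ (n + 1) ^ (V j - A j) ≤ ρ n ^ V j := by
      calc ρ n ^ A j * ρ (n + 1) ^ (V j - A j) ≤ ρ n ^ A j * ρ n ^ (V j - A j) :=
            mul_le_mul_of_nonneg_left (pow_le_pow_left₀ (hρ0 _) hρmono _) (pow_nonneg (hρ0 _) _)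
        _ = ρ n ^ V j := by rw [← pow_add, Nat.add_sub_cancel' hAVj]
    have hP2 : ρ (n + 1) ^ A j * ρ n ^ (V j - A j) ≤ ρ n ^ V j := by
      calc ρ (n + 1) ^ A j * ρ n ^ (V j - A j) ≤ ρ n ^ A j * ρ n ^ (V j - A j) :=
            mul_le_mul_of_nonneg_right (pow_le_pow_left₀ (hρ0 _) hρmono _) (pow_nonneg (hρ0 _) _)
        _ = ρ n ^ V j := by rw [← pow_add, Nat.add_sub_cancel' hAVj]
    have hn1 : (0 : ℝ) < (n : ℝ) + 1 := by positivity
    have hn2 : (0 : ℝ) < (n : ℝ) + 2 := by positivity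
    have hq1 : ((n : ℝ) + 1) / ((n : ℝ) + 2) ≤ 1 := (div_le_one hn2).2 (by linarith)
    have hq2 : ((n : ℝ) + 2) / ((n : ℝ) + 1) ≤ 2 := by rw [div_le_iff₀ hn1]; linarith
    have hρV : 0 ≤ ρ n ^ V j := pow_nonneg (hρ0 _) _
    have hT0 : 0 ≤ (1 / 2 : ℝ) * (ρ n ^ A j * ((n : ℝ) + 1) * ρ (n + 1) ^ (V j - A j) / ((n : ℝ) + 2) +
        ρ (n + 1) ^ A j * ((n : ℝ) + 2) * ρ n ^ (V j - A j) / ((n : ℝ) + 1)) :=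
      mul_nonneg (by norm_num) (add_nonneg
        (div_nonneg (mul_nonneg (mul_nonneg (pow_nonneg (hρ0 n) _) hn1.le) (pow_nonneg (hρ0 _) _)) hn2.le)
        (div_nonneg (mul_nonneg (mul_nonneg (pow_nonneg (hρ0 _) _) hn2.le) (pow_nonneg (hρ0 n) _)) hn1.le))
    rw [Real.norm_of_nonneg hT0]
    have e : (1 / 2 : ℝ) * (ρ n ^ A j * ((n : ℝ) + 1) * ρ (n + 1) ^ (V j - A j) / ((n : ℝ) + 2) +
        ρ (n + 1) ^ A j * ((n : ℝ) + 2) * ρ n ^ (V j - A j) / ((n : ℝ) + 1)) =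
        (1 / 2) * ((ρ n ^ A j * ρ (n + 1) ^ (V j - A j)) * (((n : ℝ) + 1) / ((n : ℝ) + 2)) +
          (ρ (n + 1) ^ A j * ρ n ^ (V j - A j)) * (((n : ℝ) + 2) / ((n : ℝ) + 1))) := by ring
    rw [e]
    have t1 := mul_le_mul hP1 hq1 (by positivity) hρV
    have t2 := mul_le_mul hP2 hq2 (by positivity) hρV
    nlinarith [t1, t2, hpow, hρV]

/-! ### 3. The continuum limit of the Wilson loop -/

variable {Ls : ℕ → ℕ} [hNZ : ∀ j, NeZero (Ls j)]

/-- **THE CONTINUUM LIMIT OF THE `SU(2)` WILSON LOOPS ON THE TORUS.**  If `β_j → ∞`,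
`1 ≤ R_j ≤ L_j`, `1 ≤ T_j ≤ L_j`, `R_j T_j/β_j → a` and `L_j²/β_j → v > 0`, then the expectation of
`½ tr W_{R_j × T_j}` under theory-2's `SU(2)` Wilson measure on `(ℤ/L_j)²` converges to
`½Σ_n[e^{−a n(n+2)/4} e^{−(v−a)(n+1)(n+3)/4}(n+1)/(n+2) + e^{−a(n+1)(n+3)/4} e^{−(v−a)n(n+2)/4}(n+2)/(n+1)]
 / Σ_n e^{−v n(n+2)/4}`. -/
theorem tendsto_wilson_mean_su2a0_loop {β : ℕ → ℝ} {R T : ℕ → ℕ} {a v : ℝ} (hv0 : 0 < v)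
    (hβ : Tendsto β atTop atTop) (hR : ∀ j, 1 ≤ R j) (hRL : ∀ j, R j ≤ Ls j) (hT : ∀ j, 1 ≤ T j)
    (hTL : ∀ j, T j ≤ Ls j) (ha : Tendsto (fun j => ((R j * T j : ℕ) : ℝ) / β j) atTop (𝓝 a))
    (hv : Tendsto (fun j => ((Ls j ^ 2 : ℕ) : ℝ) / β j) atTop (𝓝 v)) :
    Tendsto (fun j => ∫ U, su2a0
        (((List.range (R j)).map fun x : ℕ => U (![(0 : ZMod (Ls j)) + x, 0], 0)).prod *
          ((List.range (T j)).map fun y : ℕ => U (![(0 : ZMod (Ls j)) + R j, 0 + y], 1)).prod *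
          (((List.range (R j)).map fun x : ℕ => U (![(0 : ZMod (Ls j)) + x, 0 + T j], 0)).prod)⁻¹ *
          (((List.range (T j)).map fun y : ℕ => U (![(0 : ZMod (Ls j)), 0 + y], 1)).prod)⁻¹)
        ∂(wilsonMeasure (d := 2) (L := Ls j) (fundamentalRep (Fin 2)) (β j))) atTop
      (𝓝 ((∑' n : ℕ, (1 / 2) *
        (Real.exp (-(a * (n : ℝ) * (n + 2) / 4)) * ((n : ℝ) + 1) *
            Real.exp (-((v - a) * ((n : ℝ) + 1) * (n + 3) / 4)) / ((n : ℝ) + 2) +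
          Real.exp (-(a * ((n : ℝ) + 1) * (n + 3) / 4)) * ((n : ℝ) + 2) *
            Real.exp (-((v - a) * (n : ℝ) * (n + 2) / 4)) / ((n : ℝ) + 1))) /
        ∑' n : ℕ, Real.exp (-(v * (n : ℝ) * (n + 2) / 4)))) := by
  have hAV : ∀ j, R j * T j ≤ Ls j ^ 2 := fun j => by rw [sq]; exact Nat.mul_le_mul (hRL j) (hTL j)
  have hnum := tendsto_tsum_su2_loop_terms hv0 hβ hAV ha hv
  have hden := tendsto_tsum_besselI_succ_ratio_pow hv0 hβ hv
  -- the limit denominator is positive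
  have hDpos : 0 < ∑' n : ℕ, Real.exp (-(v * (n : ℝ) * (n + 2) / 4)) := by
    have hsum : Summable fun n : ℕ => Real.exp (-(v * (n : ℝ) * (n + 2) / 4)) := by
      refine Summable.of_nonneg_of_le (fun n => (Real.exp_pos _).le) (fun n => ?_)
        (summable_exp_neg_mul_nat (by positivity : 0 < v / 2))
      refine Real.exp_le_exp.2 ?_
      have : (0 : ℝ) ≤ n := by positivity
      nlinarith [mul_nonneg hv0.le (mul_self_nonneg (n : ℝ))]
    exact hsum.tsum_pos (fun n => (Real.exp_pos _).le) 0 (Real.exp_pos _)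
  refine (hnum.div hden hDpos.ne').congr' ?_
  filter_upwards [hβ.eventually_gt_atTop 0] with j hj
  simp only [Pi.div_apply]
  rw [wilson_mean_su2a0_loop_two hj.le (0 : ZMod (Ls j)) 0 (hR j) (hRL j) (hT j) (hTL j)]
  have hI1ne : besselI 1 (2 * β j) ≠ 0 := (besselI_pos 1 (by linarith : (0 : ℝ) < 2 * β j)).ne'
  have hl0 : 0 < Real.exp (-(2 * β j)) * besselI 1 (2 * β j) / β j := by
    have := besselI_pos 1 (by linarith : (0 : ℝ) < 2 * β j); positivity
  -- rewrite every `λ_m` through the recurrence and pull out `λ_0^V`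
  simp_rw [su2_charTerm_eq hj.ne', su2_charTerm_succ_eq hj.ne']
  have hN : ∀ n : ℕ, (1 / 2 : ℝ) *
      ((Real.exp (-(2 * β j)) * besselI (n + 1) (2 * β j) / β j) ^ (R j * T j) * ((n : ℝ) + 1) *
          (Real.exp (-(2 * β j)) * besselI (n + 2) (2 * β j) / β j) ^ (Ls j ^ 2 - R j * T j) / ((n : ℝ) + 2) +
        (Real.exp (-(2 * β j)) * besselI (n + 2) (2 * β j) / β j) ^ (R j * T j) * ((n : ℝ) + 2) *
          (Real.exp (-(2 * β j)) * besselI (n + 1) (2 * β j) / β j) ^ (Ls j ^ 2 - R j * T j) / ((n : ℝ) + 1)) =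
      (Real.exp (-(2 * β j)) * besselI 1 (2 * β j) / β j) ^ (Ls j ^ 2) * ((1 / 2) *
        ((besselI (n + 1) (2 * β j) / besselI 1 (2 * β j)) ^ (R j * T j) * ((n : ℝ) + 1) *
            (besselI (n + 2) (2 * β j) / besselI 1 (2 * β j)) ^ (Ls j ^ 2 - R j * T j) / ((n : ℝ) + 2) +
          (besselI (n + 2) (2 * β j) / besselI 1 (2 * β j)) ^ (R j * T j) * ((n : ℝ) + 2) *
            (besselI (n + 1) (2 * β j) / besselI 1 (2 * β j)) ^ (Ls j ^ 2 - R j * T j) / ((n : ℝ) + 1))) := by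
    intro n
    rw [su2_loop_term_eq hj (hAV j) n]
    ring
  have hD : ∀ n : ℕ, (Real.exp (-(2 * β j)) * besselI (n + 1) (2 * β j) / β j) ^ (Ls j ^ 2) =
      (Real.exp (-(2 * β j)) * besselI 1 (2 * β j) / β j) ^ (Ls j ^ 2) *
        (besselI (n + 1) (2 * β j) / besselI 1 (2 * β j)) ^ (Ls j ^ 2) := by
    intro n
    rw [← mul_pow]
    congr 1
    field_simp
  have hNum : (∑' n : ℕ, (1 / 2 : ℝ) *
      ((Real.exp (-(2 * β j)) * besselI (n + 1) (2 * β j) / β j) ^ (R j * T j) * ((n : ℝ) + 1) *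
          (Real.exp (-(2 * β j)) * besselI (n + 2) (2 * β j) / β j) ^ (Ls j ^ 2 - R j * T j) / ((n : ℝ) + 2) +
        (Real.exp (-(2 * β j)) * besselI (n + 2) (2 * β j) / β j) ^ (R j * T j) * ((n : ℝ) + 2) *
          (Real.exp (-(2 * β j)) * besselI (n + 1) (2 * β j) / β j) ^ (Ls j ^ 2 - R j * T j) / ((n : ℝ) + 1))) =
      (Real.exp (-(2 * β j)) * besselI 1 (2 * β j) / β j) ^ (Ls j ^ 2) * ∑' n : ℕ, (1 / 2 : ℝ) *
        ((besselI (n + 1) (2 * β j) / besselI 1 (2 * β j)) ^ (R j * T j) * ((n : ℝ) + 1) *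
            (besselI (n + 2) (2 * β j) / besselI 1 (2 * β j)) ^ (Ls j ^ 2 - R j * T j) / ((n : ℝ) + 2) +
          (besselI (n + 2) (2 * β j) / besselI 1 (2 * β j)) ^ (R j * T j) * ((n : ℝ) + 2) *
            (besselI (n + 1) (2 * β j) / besselI 1 (2 * β j)) ^ (Ls j ^ 2 - R j * T j) / ((n : ℝ) + 1)) := by
    rw [← tsum_mul_left]; exact tsum_congr hN
  have hDen : (∑' n : ℕ, (Real.exp (-(2 * β j)) * besselI (n + 1) (2 * β j) / β j) ^ (Ls j ^ 2)) =
      (Real.exp (-(2 * β j)) * besselI 1 (2 * β j) / β j) ^ (Ls j ^ 2) *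
        ∑' n : ℕ, (besselI (n + 1) (2 * β j) / besselI 1 (2 * β j)) ^ (Ls j ^ 2) := by
    rw [← tsum_mul_left]; exact tsum_congr hD
  rw [hNum, hDen, mul_div_mul_left _ _ (pow_ne_zero _ hl0.ne')]

end Summit.Ventures.LatticeQCDFlow.Scoring
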